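import Summits.HubbardSuperconductivity.HubbardSuperconductivity.Theses.IsoperimetricCascade
import Literature.MathematicalPhysics.QuantumLattice.PairFieldPairedVectors
import Literature.MathematicalPhysics.QuantumLattice.DWaveGapLatticeCount

/-!
# Route `IsoperimetricCascade`, support `FlatAGPNormGrowth` (stmt-HubbardSuperconductivity-11982) — assembly

**Coleman's geminal-power norm grows like `(κL⁴)ⁿ`**: for every `δ ∈ (0,1)` and `r` there are
`κ > 0` and `L₀` with `(κL⁴)ⁿ ≤ ‖(Δ_dᴴ)ⁿ|∅⟩‖²` for all `L ≥ L₀`, `n = ⌊(1-δ)L²/2⌋ - r`.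
Assembly of the Literature files `PairFieldPairedVectors` (`‖(Δᴴ)ⁿ|∅⟩‖² ≥ (n!)² Π_{k∈S} w_k²` for every `n`-set `S` of momenta,
`w_k = 2√2 (cos p₁ - cos p₂)`) and `DWaveGapLatticeCount` (an `n`-set of momenta with `|cos p₁ - cos p₂| ≥ δ/4`
exists for large `L`), with `n! ≥ (n/e)ⁿ` (`Real.pow_div_factorial_le_exp`) and `n ≥ (1-δ)L²/4`;
`κ = 8 (δ/4)² ((1-δ)/(4e))²`. No definition is introduced.
-/

set_option linter.dupNamespace false

namespace Summit.HubbardSuperconductivity.HubbardSuperconductivity.Theorems.IsoperimetricCascade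

open Matrix Finset Real
open Literature.MathematicalPhysics.QuantumLattice Literature.Probability.LatticeModels
open Summit.HubbardSuperconductivity.HubbardSuperconductivity.Theses.IsoperimetricCascade

/-- **`FlatAGPNormGrowth` holds** (route `IsoperimetricCascade`, support item
`stmt-HubbardSuperconductivity-11982`): `(κL⁴)ⁿ ≤ ‖(Δ_dᴴ)ⁿ|∅⟩‖²` for `n = ⌊(1-δ)L²/2⌋ - r` and all
large `L`, with `κ = 8(δ/4)²((1-δ)/(4e))²`. [cite: Coleman1965, §§3–5] -/
theorem flatAGPNormGrowth_proof : FlatAGPNormGrowth := by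
  intro δ hδ r
  obtain ⟨hδ0, hδ1⟩ := hδ
  obtain ⟨L₁, hL₁⟩ := exists_card_dWaveGap_ge hδ0 hδ1
  set ε : ℝ := δ / 4 with hε
  have hε0 : 0 < ε := by rw [hε]; positivity
  set κ : ℝ := 8 * ε ^ 2 * ((1 - δ) / (4 * Real.exp 1)) ^ 2 with hκ
  have h1δ : 0 < 1 - δ := by linarith
  have hκ0 : 0 < κ := by rw [hκ]; positivity
  refine ⟨κ, hκ0, max L₁ (⌈4 * (r + 1) / (1 - δ)⌉₊ + 1), fun L _ hL => ?_⟩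
  dsimp only
  set n : ℕ := ⌊(1 - δ) * (L : ℝ) ^ 2 / 2⌋₊ - r with hn
  have hL1 : L₁ ≤ L := (le_max_left _ _).trans hL
  have hLpos : (0 : ℝ) < L := by exact_mod_cast Nat.pos_of_ne_zero (NeZero.ne L)
  have hL2 : 4 * (r + 1) / (1 - δ) ≤ L := by
    have h1 := Nat.le_ceil (4 * (r + 1) / (1 - δ))
    have h2 : ((⌈4 * ((r : ℝ) + 1) / (1 - δ)⌉₊ + 1 : ℕ) : ℝ) ≤ L := by
      exact_mod_cast (le_max_right _ _).trans hL
    push_cast at h2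
    linarith
  -- `n` is comparable to `(1-δ)L²/2`
  have hfloor := Nat.floor_le (by positivity : 0 ≤ (1 - δ) * (L : ℝ) ^ 2 / 2)
  have hfloor' := Nat.lt_floor_add_one ((1 - δ) * (L : ℝ) ^ 2 / 2)
  have hbig : (r : ℝ) + 1 ≤ (1 - δ) * (L : ℝ) ^ 2 / 4 := by
    rw [div_le_iff₀ h1δ] at hL2
    have hL1' : (1 : ℝ) ≤ L := by exact_mod_cast Nat.pos_of_ne_zero (NeZero.ne L)
    nlinarith
  have hrle : r ≤ ⌊(1 - δ) * (L : ℝ) ^ 2 / 2⌋₊ := by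
    have : (r : ℝ) ≤ ⌊(1 - δ) * (L : ℝ) ^ 2 / 2⌋₊ := by linarith
    exact_mod_cast this
  have hnR : (n : ℝ) = (⌊(1 - δ) * (L : ℝ) ^ 2 / 2⌋₊ : ℝ) - r := by
    rw [hn, Nat.cast_sub hrle]
  have hnle : (n : ℝ) ≤ (1 - δ) / 2 * (L : ℝ) ^ 2 := by rw [hnR]; linarith [Nat.cast_nonneg (α := ℝ) r]
  have hnge : (1 - δ) * (L : ℝ) ^ 2 / 4 ≤ n := by rw [hnR]; linarith
  -- an `n`-set of non-nodal momenta
  have hG := hL₁ L hL1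
  obtain ⟨S, hSG, hScard⟩ := Finset.exists_subset_card_eq
    (s := Finset.univ.filter fun k : TorusSite 2 L => δ / 4 ≤ |dWaveGap k|) (n := n)
    (by exact_mod_cast hnle.trans hG)
  -- part A on `S`
  have hA := norm_sq_pow_conjTranspose_pairField_vacuum_ge S
  rw [hScard] at hA
  -- the product of the weights
  have hprod : (2 * Real.sqrt 2 * ε) ^ n ≤ ∏ k ∈ S, |pairFieldMode dWaveFormFactor L k| := by
    rw [← hScard, ← Finset.prod_const]
    refine Finset.prod_le_prod (fun k _ => by positivity) fun k hk => ?_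
    have hk' := (Finset.mem_filter.1 (hSG hk)).2
    rw [pairFieldMode_dWaveFormFactor, abs_mul, abs_of_pos (by positivity : (0 : ℝ) < 2 * Real.sqrt 2)]
    exact mul_le_mul_of_nonneg_left hk' (by positivity)
  -- numerics
  -- Stirling's elementary lower bound `(n/e)ⁿ ≤ n!` (inlined; cf. the landed
  -- `Literature.Barriers.ValiantsHypothesis.pow_div_exp_le_factorial`)
  have hfac : ((n : ℝ) / Real.exp 1) ^ n ≤ (n.factorial : ℝ) := by
    have h := Real.pow_div_factorial_le_exp (n : ℝ) (Nat.cast_nonneg _) n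
    have hfac0 : (0 : ℝ) < n.factorial := by exact_mod_cast Nat.factorial_pos n
    have he : Real.exp (n : ℝ) = Real.exp 1 ^ n := by rw [← Real.exp_nat_mul, mul_one]
    rw [div_le_iff₀ hfac0, he] at h
    rw [div_pow, div_le_iff₀ (by positivity)]
    linarith
  have hbase : κ * (L : ℝ) ^ 4 ≤ ((n : ℝ) / Real.exp 1) ^ 2 * (2 * Real.sqrt 2 * ε) ^ 2 := by
    have hsq : Real.sqrt 2 ^ 2 = 2 := Real.sq_sqrt (by norm_num)
    have h1 : (1 - δ) * (L : ℝ) ^ 2 / (4 * Real.exp 1) ≤ (n : ℝ) / Real.exp 1 := by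
      rw [div_le_div_iff₀ (by positivity) (Real.exp_pos 1)]
      nlinarith [Real.exp_pos 1]
    have h1' : ((1 - δ) * (L : ℝ) ^ 2 / (4 * Real.exp 1)) ^ 2 ≤ ((n : ℝ) / Real.exp 1) ^ 2 :=
      pow_le_pow_left₀ (by positivity) h1 2
    calc κ * (L : ℝ) ^ 4 = ((1 - δ) * (L : ℝ) ^ 2 / (4 * Real.exp 1)) ^ 2 * (2 * Real.sqrt 2 * ε) ^ 2 := by
          rw [hκ, mul_pow, mul_pow, hsq]; ring
      _ ≤ ((n : ℝ) / Real.exp 1) ^ 2 * (2 * Real.sqrt 2 * ε) ^ 2 :=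
          mul_le_mul_of_nonneg_right h1' (by positivity)
  have hmid : ((n : ℝ) / Real.exp 1) ^ n * (2 * Real.sqrt 2 * ε) ^ n ≤
      (n.factorial : ℝ) * ∏ k ∈ S, |pairFieldMode dWaveFormFactor L k| :=
    mul_le_mul hfac hprod (by positivity) (by positivity)
  calc (κ * (L : ℝ) ^ 4) ^ n ≤ (((n : ℝ) / Real.exp 1) ^ 2 * (2 * Real.sqrt 2 * ε) ^ 2) ^ n :=
        pow_le_pow_left₀ (by positivity) hbase n
    _ = (((n : ℝ) / Real.exp 1) ^ n * (2 * Real.sqrt 2 * ε) ^ n) ^ 2 := by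
        rw [← mul_pow, ← mul_pow, ← pow_mul, ← pow_mul, mul_comm 2 n]
    _ ≤ ((n.factorial : ℝ) * ∏ k ∈ S, |pairFieldMode dWaveFormFactor L k|) ^ 2 :=
        pow_le_pow_left₀ (by positivity) hmid 2
    _ ≤ _ := hA

end Summit.HubbardSuperconductivity.HubbardSuperconductivity.Theorems.IsoperimetricCascade
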